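import Mathlib
import Literature.Computability.Complexity.RandomKSatEnsembleOGP

/-!
# Route OverlapGapAlgebra, crux `SearchHardWindow` (stmt-PneNP-2460): slot factorization of the
# multi-time weight of the resampling chain

Step F of the first moment for the ensemble OGP (Huang–Sellke 2025, Lemma 3.22) in line `Sketch`.
After the finite-dimensional marginal, the survival weight of a tuple is an explicit `(L+1)`-fold sum
over arrays `x : Fin (L+1) → A × B → Γ` (clause slots `A` × positions `B`, alphabet `Γ`), weighted
by `∏_ℓ P_{δ ℓ}(x ℓ, x (ℓ+1))` (`resampleKernel` of
`Literature/Computability/Complexity/RandomKSatEnsembleOGP.lean`), of the indicator of a CONJUNCTION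
over the slots `a : A` of per-slot events `E a` reading only the slot `fun ℓ b => x ℓ (a, b)`.
`stub_slotFactorization`: this weighted count is the PRODUCT over the slots of the per-slot weighted
counts. Pure finite algebra:
* `sfz_kernel_slot`: the kernel on `A × B → Γ` is a product of one factor per coordinate, hence
  (`Fintype.prod_prod_type`) the product over `a` of the kernels of the slots `fun b => y (a, b)`;
* `sfz_weight_slot`: so is the path weight (`Finset.prod_comm`);
* `sfz_ite_forall_eq_prod`: the indicator of `∀ a, p a` is `∏ a, [p a]`;
* the summand is therefore `∏ a, G a (slot a of x)`; reindexing the sum along the equivalence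
  `(Fin (L+1) → A × B → Γ) ≃ (A → Fin (L+1) → B → Γ)` (`Fintype.sum_equiv`) and
  `∏ a, ∑ w, G a w = ∑ y, ∏ a, G a (y a)` (`Fintype.prod_sum`) finish.
-/

set_option linter.dupNamespace false -- `Summit.PneNP.PneNP.…`: summit = sub-problem

namespace Summit.PneNP.PneNP.Theorems

open Finset
open Literature.Computability.Complexity
open scoped Classical

/-- The `ε`-resampling kernel on the product index set `A × B` factors over the slots `a : A` into
the kernels of the rows `fun b => y (a, b)`. -/
theorem sfz_kernel_slot {A B Γ : Type} [Fintype A] [Fintype B] [Fintype Γ] [DecidableEq Γ]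
    (ε : ℝ) (y y' : A × B → Γ) :
    resampleKernel ε y y' =
      ∏ a : A, resampleKernel ε (fun b => y (a, b)) (fun b => y' (a, b)) := by
  unfold resampleKernel
  exact Fintype.prod_prod_type _

/-- The weight of a path of arrays indexed by `A × B` is the product over the slots `a : A` of the
weights of its rows. -/
theorem sfz_weight_slot {A B Γ : Type} [Fintype A] [Fintype B] [Fintype Γ] [DecidableEq Γ]
    (L : ℕ) (δ : Fin L → ℝ) (x : Fin (L + 1) → A × B → Γ) :
    ∏ ℓ : Fin L, resampleKernel (δ ℓ) (x ℓ.castSucc) (x ℓ.succ) =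
      ∏ a : A, ∏ ℓ : Fin L,
        resampleKernel (δ ℓ) (fun b => x ℓ.castSucc (a, b)) (fun b => x ℓ.succ (a, b)) := by
  rw [Finset.prod_comm]
  exact Finset.prod_congr rfl fun ℓ _ => sfz_kernel_slot (δ ℓ) (x ℓ.castSucc) (x ℓ.succ)

/-- The indicator of a finite conjunction is the product of the indicators (any `Decidable`
instances). -/
theorem sfz_ite_forall_eq_prod {A : Type} [Fintype A] (p : A → Prop) {hp : DecidablePred p}
    {hq : Decidable (∀ a, p a)} :
    (if ∀ a, p a then (1 : ℝ) else 0) = ∏ a, if p a then (1 : ℝ) else 0 := by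
  by_cases h : ∀ a, p a
  · rw [if_pos h]
    exact (Finset.prod_eq_one fun a _ => if_pos (h a)).symm
  · rw [if_neg h]
    push Not at h
    obtain ⟨a, ha⟩ := h
    exact (Finset.prod_eq_zero (Finset.mem_univ a) (if_neg ha)).symm

/-- STUB F — **slot factorization**: the weighted count, over paths `x : Fin (L+1) → A × B → Γ` of
the resampling chain with step parameters `δ ℓ`, of the conjunction over the slots `a : A` of events
`E a` reading only the slot `fun ℓ b => x ℓ (a, b)`, equals the product over `a` of the per-slot
weighted counts. -/
theorem stub_slotFactorization {A B Γ : Type} [Fintype A] [DecidableEq A] [Fintype B] [DecidableEq B]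
    [Fintype Γ] [DecidableEq Γ] (L : ℕ) (δ : Fin L → ℝ) (E : A → (Fin (L + 1) → B → Γ) → Prop) :
    (∑ x : Fin (L + 1) → A × B → Γ,
        (∏ ℓ : Fin L, resampleKernel (δ ℓ) (x ℓ.castSucc) (x ℓ.succ)) *
          (if ∀ a, E a (fun ℓ b => x ℓ (a, b)) then (1 : ℝ) else 0)) =
      ∏ a : A, ∑ w : Fin (L + 1) → B → Γ,
        (∏ ℓ : Fin L, resampleKernel (δ ℓ) (w ℓ.castSucc) (w ℓ.succ)) *
          (if E a w then (1 : ℝ) else 0) := by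
  rw [Fintype.prod_sum]
  refine Fintype.sum_equiv
    ⟨fun x a ℓ b => x ℓ (a, b), fun y ℓ p => y p.1 ℓ p.2, fun x => rfl, fun y => rfl⟩ _ _
    (fun x => ?_)
  simp only [Equiv.coe_fn_mk]
  rw [Finset.prod_mul_distrib, sfz_weight_slot L δ x]
  congr 1
  exact sfz_ite_forall_eq_prod _

end Summit.PneNP.PneNP.Theorems
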